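import Mathlib
import HarnessLib
import Summits.HubbardSuperconductivity.HubbardSuperconductivity.Theorems.KLProgrammeKLRegimeSectorSliceAlphaFatRows
import Summits.HubbardSuperconductivity.HubbardSuperconductivity.Theorems.KLProgrammeKLRegimeAlphaFatScalars
import Summits.HubbardSuperconductivity.HubbardSuperconductivity.Theorems.KLProgrammeKLRegimeAlphaFatScalars2
import Summits.HubbardSuperconductivity.HubbardSuperconductivity.Theorems.KLProgrammeKLRegimeSliceRates

/-!
# Route `KLProgramme` — engine support, route (L2), FAT layer 5c: **`α_n` in CLOSED FORM** — `hrow`/`hcol` of the fat sector family at scale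
# `m+1` and the slice with lower scale `Λ = Λ_{m+1}` are `≤ 288·√(32·C_W·C_N)·(M/β)/Λ_{m+1}`, `C_W, C_N` frame/cutoff constants only

Cell `gate-hubbard-kl`, seat hubbard-kl-k3c2-p3; gen-4 ENGINE child stmt-HubbardSuperconductivity-19855 (`stub_engine_step_norms`).  The engine
instance of `rowSum_sliceCT_bgmFat_le`: `Λ = klScale e₀ (m+1)` (so `Λ_m = 4Λ`), tangent resolution `N_r = 2^{m+1}` (`N_r²Λ = e₀`,
`w_{m+1} = π/N_r`), canonical rates in closed form (`1/s₀ = x₀(M/β)/Λ`, `1/s₁ = x₁/Λ`, `s₂ = 2Λ/(π(N_r+½)√q_e)`, `s₃ = 2/(π(N_r+½)N_r√q_v)`),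
the five rate hypotheses discharged by `…AlphaFatScalars`, and the product collapsed by `…AlphaFatScalars2`:

* **`slicePair_bgmFat_closed`** (here) and `rowSum_/colSum_sliceCT_bgmFat_closed` (companion file `…AlphaFatClosedRows`) — under `e₀ ≤ 1`, `β ≤ M`, `0 < K₁`, `π ≤ Λ_mβ`, `δ_L ≤ Λ²L`,
  `L/(10N_r) ≤ R₀`, `2(2N_r+1)R₀ < L`, `2π·N_r(N_r+½) ≤ L`, `2|2π/L|(N_r+½) ≤ z`, `γπ ≤ 2√2·L·Λ` (`γ = 2ρ_min − 4A`):
  `Σ_{Y′}‖(S(Ft)ᵀ C S(Ft)) Y Y′‖ ≤ 288·√(32·C_W·C_N)·(M/β)/Λ`, with the abbreviation hypotheses `h…` (`:= rfl`) spelling `C_W, C_N` out.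

n-UNIFORMITY: `C_W, C_N` depend on `(B, A, e₀, d, Ba, K₁, K₂, B₁, B₂, δ_L)` only; the thresholds are `L ≳ 4^{m+1}` and `Λ²L ≥ δ_L` (i.e.
`L ≳ 16^{m+1}`, `≲ β²` at the last scale).  Everything is proved; no definitions. [folklore] (BGM 2006 §2.8 (2.81).)
-/

noncomputable section

namespace Summit.HubbardSuperconductivity.HubbardSuperconductivity.Theorems.TorusFourierL2

set_option linter.dupNamespace false -- summit = problem name (single-conjunct summit), D-0017

open Set Finset Literature.MathematicalPhysics.QuantumLattice Literature.MathematicalPhysics.QuantumLattice.BandSectorCounting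
open Literature.MathematicalPhysics.QuantumLattice.FermiRG Literature.Probability.LatticeModels Literature.Analysis.SpecialFunctions
open Summit.HubbardSuperconductivity.HubbardSuperconductivity.Theorems.DispersionFlow
open Summit.HubbardSuperconductivity.HubbardSuperconductivity.Theorems.KLRegimeSplit
open Summit.HubbardSuperconductivity.HubbardSuperconductivity.Theorems.KLProgrammeLegKernels
open Summit.HubbardSuperconductivity.HubbardSuperconductivity.Theorems.PerturbedFermiCurve
open scoped Real Nat

section Closed

open Classical

variable {L M : ℕ} [NeZero L] [NeZero M] {a b : ℝ} (B : BandBounds a b) {K : TrigPolyC4v} {A : ℝ}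
  (hA : ∀ p : Momentum, ∀ j ≤ 2, ‖iteratedFDeriv ℝ j (frameShift K) p‖ ≤ A) (hADt : 2 * A < B.Dtmin)
  {μ e₀ z β : ℝ} (he : 0 < e₀) (hz : 0 < z) (hz1 : z ≤ 1) (hgap : e₀ + A + z ^ 2 < -μ) (h3 : e₀ + A - μ ≤ 3)
  (hlo : a ≤ μ - A - e₀) (hhi : μ + A + e₀ ≤ b) (hβ : 0 < β) (hρA : 4 * A < 2 * B.rhomin)
  (m : ℕ) (hMm : klScale e₀ m * β < π * (2 * M - 3))
  {d : ℝ} (hd : 0 ≤ d) (hd1 : ∀ u, |deriv (bgmCutoffSq e₀) u| ≤ d) (hd2 : ∀ u, |iteratedDeriv 2 (bgmCutoffSq e₀) u| ≤ d)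
  {Ba : ℝ} (hB0 : 0 ≤ Ba)
  (hB : ∀ (i : ℕ), i ≤ 2 → ∀ (n : ℕ) (ω : ℤ) (θ₀ : ℝ) (q w : Fin 2 → ℝ) (t : ℝ) {r₀ : ℝ}, 0 < r₀ →
    r₀ ≤ ‖momToComplex (q + t • w)‖ → |sectorRelAngle θ₀ (q + t • w)| < π →
    ‖iteratedDeriv i (fun t : ℝ => sectorWeightCirc n ω (polarAngle (q + t • w))) t‖ ≤
      (2 : ℕ)! * Ba * ((1 + (sectorWidth n)⁻¹ * (2 : ℕ)!) * ‖momToComplex w‖ / r₀) ^ i)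
  {Λ' : ℝ} (hΛΛ' : klScale e₀ (m + 1) ≤ Λ') (hM' : Λ' < π * (2 * M - 3) / β)
  {K₁ K₂ : ℝ} (hK₁pos : 0 < K₁) (hK₁ : ∀ p, ‖fderiv ℝ (frameLevel μ K) p‖ ≤ K₁) (hK₂ : ∀ p, ‖iteratedFDeriv ℝ 2 (frameLevel μ K) p‖ ≤ K₂)
  {B₁ B₂ : ℝ} (hB₁ : ∀ x, |deriv salmhoferCutoff x| ≤ B₁) (hB₂ : ∀ x, |deriv (deriv salmhoferCutoff) x| ≤ B₂)
  -- regime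
  (he₁ : e₀ ≤ 1) (hβM : β ≤ (M : ℝ)) (hπβ : π ≤ klScale e₀ m * β)
  (hLz : 2 * |2 * π / L| * ((2 : ℝ) ^ (m + 1) + 1 / 2) ≤ z) (hLN : 2 * π * (2 : ℝ) ^ (m + 1) * ((2 : ℝ) ^ (m + 1) + 1 / 2) ≤ L)
  (hL1 : (2 * B.rhomin - 4 * A) * π ≤ 2 * Real.sqrt 2 * L * klScale e₀ (m + 1))
  {R₀ : ℕ} (hR₀ : 2 * (2 * (2 : ℝ) ^ (m + 1) + 1) * (R₀ : ℝ) < L) (hR₀' : (L : ℝ) / (10 * (2 : ℝ) ^ (m + 1)) ≤ R₀)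
  {δL : ℝ} (hδL : 0 < δL) (hΛL : δL ≤ klScale e₀ (m + 1) ^ 2 * L)
  -- the closed-form constants (instantiate with `rfl`)
  {cρ G₁ G₂ Kp b₁ bτ ae1 ae2 qe av1 av2 qv Dt x₀ x₁ x₂ x₃ c₁ CW CN : ℝ}
  (hcρ : cρ = (2 * e₀ / π + B.smax * B.Dtmin * (3 / 4)) / (B.Dtmin - 2 * A) + π * Real.sqrt 2 * (1 + (4 + 2 * A) / (B.Dtmin - 2 * A)))
  (hG₁ : G₁ = d * e₀ ^ 2 * 1 + 1 * (d * e₀ ^ 2)) (hG₂ : G₂ = d * e₀ ^ 4 * 1 + 2 * (d * e₀ ^ 2) * (d * e₀ ^ 2) + 1 * (d * e₀ ^ 4))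
  (hKp : Kp = 4 + 4 * A) (hb₁ : b₁ = 4 + 2 * A + Kp * (cρ * π + 2)) (hbτ : bτ = 4 + 2 * A + 2 * K₂ * (cρ * π))
  (hae1 : ae1 = G₁ * (4 + 2 * A + Kp * (cρ * π + 2)) / 2 + 72 * Ba * e₀)
  (hae2 : ae2 = (4 * G₂ + 2 * G₁) * (4 + 2 * A + Kp * (cρ * π + 2)) ^ 2 / 16 + G₁ * Kp * e₀ / 2 +
    144 * G₁ * (4 + 2 * A + Kp * (cρ * π + 2)) * Ba * e₀ + 36 * (4 * Ba + 8 * Ba ^ 2) * e₀ ^ 2)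
  (hqe : qe = (32 * B₂ + 144 * B₁ + 128) * (Real.sqrt 2 * K₁ + 8 * K₂) ^ 2 / 4 + (16 * B₁ + 16) * K₂ * e₀ / 2 +
    ae1 * (16 * B₁ + 16) * (Real.sqrt 2 * K₁ + 6 * K₂) / 2 + ae2)
  (hav1 : av1 = G₁ * (4 + 2 * A + Kp * (cρ * π + 2)) / (2 * e₀) + 288 * Ba)
  (hav2 : av2 = (4 * G₂ + 2 * G₁) * (4 + 2 * A + Kp * (cρ * π + 2)) ^ 2 / (16 * e₀ ^ 2) + G₁ * Kp / (2 * e₀) +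
    144 * G₁ * (4 + 2 * A + Kp * (cρ * π + 2)) * Ba / e₀ + 144 * (4 * Ba + 8 * Ba ^ 2))
  (hqv : qv = (32 * B₂ + 144 * B₁ + 128) * (bτ + 8 * K₂) ^ 2 / (4 * e₀ ^ 2) + (16 * B₁ + 16) * K₂ / (2 * e₀) +
    av1 * (16 * B₁ + 16) * (bτ + 6 * K₂) / (2 * e₀) + av2)
  (hDt : Dt = (32 * B₂ + 144 * B₁ + 128) + G₁ * (16 * B₁ + 16) + G₂ + G₁ / 2)
  (hx₀ : x₀ = π / 2 * Real.sqrt Dt) (hx₁ : x₁ = π / 2 * Real.sqrt qe) (hx₂ : x₂ = 5 * π / 4 * Real.sqrt qe) (hx₃ : x₃ = 5 * π / 4 * Real.sqrt qv)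
  (hc₁ : c₁ = 4 + Kp * cρ ^ 2 * π ^ 2 / e₀)
  (hCW : CW = 4096 * x₀ * (4 * ((2 * Real.sqrt 2 * x₂ + 2) * (2 * Real.sqrt 2 * x₃ + 1)) + 160 * x₁ * (x₁ + 1) ^ 2 / δL))
  (hCN : CN = 128 * c₁ * cρ / (π ^ 2 * (2 * B.rhomin - 4 * A)))

include B hA hADt he hz hz1 hgap h3 hlo hhi hβ hρA hMm hd hd1 hd2 hB0 hB hΛΛ' hM' hK₁pos hK₁ hK₂ hB₁ hB₂ he₁ hβM hπβ hLz hLN hL1 hR₀ hR₀' hδL hΛL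
  hcρ hG₁ hG₂ hKp hb₁ hbτ hae1 hae2 hqe hav1 hav2 hqv hDt hx₀ hx₁ hx₂ hx₃ hc₁ hCW hCN

set_option maxHeartbeats 1600000 in
/-- **The uniform per-pair bound in closed form** (`T_max ≤ 4√(32·C_W·C_N)·(M/β)/Λ`). [cite: BenfattoGiulianiMastropietro2006, §2.8 (2.81)] -/
theorem slicePair_bgmFat_closed (ω ω' : Fin (sectorCount (m + 1))) :
    ∑ z : TorusSite 1 (2 * M) × TorusSite 2 L,
        ‖∑ q : TorusSite 1 (2 * M) × TorusSite 2 L, (torusChar q.1 z.1 * torusChar q.2 z.2) •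
          ((((1 / (β * (L : ℝ) ^ 2) : ℝ) : ℂ) ^ 2 *
            (bgmFatMultiplier L M e₀ β (nambuXiCT L μ K) (m + 1) ω (⟨(q.1 0).val, ZMod.val_lt (q.1 0)⟩, q.2) *
              bgmFatMultiplier L M e₀ β (nambuXiCT L μ K) (m + 1) ω' (⟨(q.1 0).val, ZMod.val_lt (q.1 0)⟩, q.2) *
              sliceSymbolFnXi (β * (L : ℝ) ^ 2) 0 (klScale e₀ (m + 1)) Λ' (matsubaraFreq β M ⟨(q.1 0).val, ZMod.val_lt (q.1 0)⟩)
                (nambuXiCT L μ K q.2))))‖ ≤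
      4 * Real.sqrt (32 * CW * CN) * ((M : ℝ) / β) / klScale e₀ (m + 1) := by
  -- the scales and the tangent resolution
  have hπ := Real.pi_pos
  have hL : (0 : ℝ) < L := Nat.cast_pos.2 (Nat.pos_of_ne_zero (NeZero.ne L))
  have hMpos : (0 : ℝ) < M := lt_of_lt_of_le hβ hβM
  set Λ : ℝ := klScale e₀ (m + 1) with hΛdef
  set Nr : ℝ := (2 : ℝ) ^ (m + 1) with hNrdef
  have hΛ : 0 < Λ := by rw [hΛdef, klScale]; positivity
  have hNr2 : 2 ≤ Nr := by
    rw [hNrdef]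
    calc (2 : ℝ) = 2 ^ 1 := by norm_num
      _ ≤ 2 ^ (m + 1) := pow_le_pow_right₀ (by norm_num) (by omega)
  have hNr0 : 0 < Nr := by linarith only [hNr2]
  have hNr1 : 1 ≤ Nr := by linarith only [hNr2]
  have hNrsq : Nr ^ 2 = (4 : ℝ) ^ (m + 1) := by
    rw [hNrdef, ← pow_mul, show (4 : ℝ) = 2 ^ 2 by norm_num, ← pow_mul]; ring_nf
  have hNrΛ : Nr ^ 2 * Λ = e₀ := by rw [hNrsq, hΛdef, klScale]; field_simp
  have hΛm : klScale e₀ m = 4 * Λ := by rw [hΛdef, klScale, klScale, pow_succ]; field_simp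
  have hΛm0 : 0 < klScale e₀ m := by rw [hΛm]; positivity
  have hΛe : Λ ≤ e₀ := klScale_le_e0 he.le (m + 1)
  have hNrΛ' : Nr * Λ ≤ e₀ / 2 := by
    have : Nr * Λ = e₀ / Nr := by
      rw [eq_div_iff hNr0.ne', ← hNrΛ]; ring
    rw [this]; exact div_le_div_of_nonneg_left he.le (by norm_num) hNr2
  have hw : sectorWidth (m + 1) = π / Nr := by rw [sectorWidth, hNrdef]
  have hwsi : 1 + 2 * (sectorWidth (m + 1))⁻¹ ≤ 2 * Nr := by
    rw [hw, inv_div]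
    have : 2 * (Nr / π) ≤ Nr := by
      rw [mul_div_assoc']; rw [div_le_iff₀ hπ]; nlinarith only [Real.pi_gt_three, hNr0]
    linarith only [this, hNr2]
  have hwsi0 : 0 ≤ (sectorWidth (m + 1))⁻¹ := by rw [hw]; positivity
  -- constants: nonnegativity
  have hA0 : 0 ≤ A := (norm_nonneg _).trans (hA 0 0 (by norm_num))
  have hK10 : 0 ≤ K₁ := hK₁pos.le
  have hK20 : 0 ≤ K₂ := le_trans (norm_nonneg _) (hK₂ 0)
  have hB10 : 0 ≤ B₁ := (abs_nonneg _).trans (hB₁ 0)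
  have hB20 : 0 ≤ B₂ := (abs_nonneg _).trans (hB₂ 0)
  have hDt0 : 0 < B.Dtmin - 2 * A := by linarith only [hADt]
  have hγ : 0 < 2 * B.rhomin - 4 * A := by linarith only [hρA]
  have hcρ0 : 0 ≤ cρ := by rw [hcρ]; have := B.smax_pos; have := B.Dtmin_pos; positivity
  have hG₁0 : 0 ≤ G₁ := by rw [hG₁]; positivity
  have hG₂0 : 0 ≤ G₂ := by rw [hG₂]; positivity
  have hKp0 : 0 ≤ Kp := by rw [hKp]; positivity
  have hb₁0 : 0 ≤ b₁ := by rw [hb₁]; positivity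
  have hbτ0 : 0 ≤ bτ := by rw [hbτ]; positivity
  have hae10 : 0 ≤ ae1 := by rw [hae1]; positivity
  have hae20 : 0 ≤ ae2 := by rw [hae2]; positivity
  have hqe0 : 0 < qe := by
    rw [hqe]
    have h1 : 0 < (32 * B₂ + 144 * B₁ + 128) * (Real.sqrt 2 * K₁ + 8 * K₂) ^ 2 / 4 := by
      have : 0 < Real.sqrt 2 * K₁ + 8 * K₂ := by positivity
      positivity
    positivity
  have hav10 : 0 ≤ av1 := by rw [hav1]; positivity
  have hav20 : 0 ≤ av2 := by rw [hav2]; positivity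
  have hqv0 : 0 < qv := by
    rw [hqv]
    have : 0 < (32 * B₂ + 144 * B₁ + 128) * (bτ + 8 * K₂) ^ 2 / (4 * e₀ ^ 2) := by
      have : 0 < bτ + 8 * K₂ := by rw [hbτ]; positivity
      positivity
    positivity
  have hDtpos : 0 < Dt := by rw [hDt]; positivity
  have hx₀0 : 0 < x₀ := by rw [hx₀]; positivity
  have hx₁0 : 0 < x₁ := by rw [hx₁]; positivity
  have hx₂0 : 0 ≤ x₂ := by rw [hx₂]; positivity
  have hx₃0 : 0 ≤ x₃ := by rw [hx₃]; positivity
  have hc₁0 : 0 ≤ c₁ := by rw [hc₁]; positivity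
  have hCW0 : 0 ≤ CW := by rw [hCW]; positivity
  have hCN0 : 0 ≤ CN := by rw [hCN]; positivity
  -- the steps
  set ℓ₁ : ℝ := 2 * π / L with hℓ₁
  set ℓ : ℝ := 2 * π / L * (Nr + 1 / 2) with hℓ
  have hℓ₁0 : 0 < ℓ₁ := by positivity
  have hℓ0 : 0 < ℓ := by positivity
  have hℓNr : ℓ * Nr ≤ 1 := by
    rw [hℓ, div_mul_eq_mul_div, div_mul_eq_mul_div, div_le_one hL]; linarith only [hLN]
  have hℓle1 : ℓ ≤ 1 := le_trans (le_mul_of_one_le_right hℓ0.le hNr1) hℓNr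
  have hℓ₁ℓNr : ℓ₁ ≤ ℓ / Nr := by
    rw [hℓ, hℓ₁, le_div_iff₀ hNr0]
    exact mul_le_mul_of_nonneg_left (by linarith only []) (by positivity)
  have hℓ₁le1 : ℓ₁ ≤ 1 := hℓ₁ℓNr.trans ((div_le_self hℓ0.le hNr1).trans hℓle1)
  have habs : |2 * π / (L : ℝ)| = ℓ₁ := abs_of_pos hℓ₁0
  -- the cell radius
  set ρf : ℝ := (klScale e₀ m + B.smax * B.Dtmin * (3 * sectorWidth (m + 1) / 4)) / (B.Dtmin - 2 * A) +
    π * Real.sqrt 2 * (1 + (4 + 2 * A) / (B.Dtmin - 2 * A)) * sectorWidth (m + 1) with hρf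
  have hρf0 : 0 ≤ ρf := by rw [hρf]; have := B.smax_pos; have := B.Dtmin_pos; have := sectorWidth_pos (m + 1); positivity
  have hρfb : ρf ≤ cρ * π / Nr := by
    rw [hρf, hcρ, hw, hΛm]
    have h4Λ : 4 * Λ ≤ 2 * e₀ / π * (π / Nr) := by
      have e : 2 * e₀ / π * (π / Nr) = 2 * e₀ / Nr := by field_simp
      rw [e, le_div_iff₀ hNr0]
      have := mul_le_mul_of_nonneg_left hNrΛ' (by norm_num : (0:ℝ) ≤ 4)
      linarith only [this]
    have hsm := B.smax_pos; have hdt := B.Dtmin_pos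
    have e2 : ((2 * e₀ / π + B.smax * B.Dtmin * (3 / 4)) / (B.Dtmin - 2 * A) + π * Real.sqrt 2 * (1 + (4 + 2 * A) / (B.Dtmin - 2 * A))) * π / Nr =
        (2 * e₀ / π * (π / Nr) + B.smax * B.Dtmin * (3 * (π / Nr) / 4)) / (B.Dtmin - 2 * A) +
          π * Real.sqrt 2 * (1 + (4 + 2 * A) / (B.Dtmin - 2 * A)) * (π / Nr) := by
      field_simp
    rw [e2]
    gcongr
  -- shell thickness for the support count
  have hsh : klScale e₀ m + Kp * ρf ^ 2 ≤ Λ * c₁ := by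
    rw [hΛm, hc₁]
    have h1 : ρf ^ 2 ≤ (cρ * π / Nr) ^ 2 := pow_le_pow_left₀ hρf0 hρfb 2
    have h2 : Kp * ρf ^ 2 ≤ Kp * (cρ * π / Nr) ^ 2 := mul_le_mul_of_nonneg_left h1 hKp0
    have e : Λ * (4 + Kp * cρ ^ 2 * π ^ 2 / e₀) = 4 * Λ + Kp * (cρ * π / Nr) ^ 2 := by
      rw [← hNrΛ]; field_simp
    rw [e]; linarith only [h2]
  -- the rates
  set s₀ : ℝ := 2 * Λ * β / ((M : ℝ) * π * Real.sqrt Dt) with hs₀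
  set s₁ : ℝ := 2 * Λ / (π * Real.sqrt qe) with hs₁
  set s₂ : ℝ := 2 * Λ / (π * (Nr + 1 / 2) * Real.sqrt qe) with hs₂
  set s₃ : ℝ := 2 / (π * (Nr + 1 / 2) * Nr * Real.sqrt qv) with hs₃
  have hsD : 0 < Real.sqrt Dt := Real.sqrt_pos.2 hDtpos
  have hse : 0 < Real.sqrt qe := Real.sqrt_pos.2 hqe0
  have hsv : 0 < Real.sqrt qv := Real.sqrt_pos.2 hqv0
  have hs₀0 : 0 < s₀ := by positivity
  have hs₁0 : 0 < s₁ := by positivity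
  have hs₂0 : 0 < s₂ := by positivity
  have hs₃0 : 0 < s₃ := by positivity
  have hsDsq : Real.sqrt Dt ^ 2 = Dt := Real.sq_sqrt hDtpos.le
  have hsesq : Real.sqrt qe ^ 2 = qe := Real.sq_sqrt hqe0.le
  have hsvsq : Real.sqrt qv ^ 2 = qv := Real.sq_sqrt hqv0.le
  -- A₀ and c₀
  have hc₀ : (0 : ℝ) ≤ (1 / (β * (L : ℝ) ^ 2)) ^ 2 := by positivity
  have hcβ : 0 ≤ β * (L : ℝ) ^ 2 := by positivity
  -- (0) time
  have hr₀ : (1 / (β * (L : ℝ) ^ 2)) ^ 2 *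
      (1 * ((2 * π / β) ^ 2 * ((32 * B₂ + 144 * B₁ + 128) * (β * (L : ℝ) ^ 2) / Λ ^ 3)) +
        2 * ((2 * G₁ * |2 * π / β| * 1 / klScale e₀ m) * ((2 * π / β) * ((16 * B₁ + 16) * (β * (L : ℝ) ^ 2) / Λ ^ 2))) +
        ((4 * G₂ + 2 * G₁) * (2 * π / β) ^ 2 * 1 / klScale e₀ m ^ 2) * (4 * (β * (L : ℝ) ^ 2) / Λ)) ≤
    (1 / (β * (L : ℝ) ^ 2)) ^ 2 * (4 * (β * (L : ℝ) ^ 2) / Λ) * (4 / (s₀ * (2 * M : ℕ))) ^ 2 := by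
    rw [timeLeibniz_eq hβ hΛ hΛm, ← hDt]
    refine le_of_eq ?_
    rw [hs₀]; push_cast; field_simp; rw [hsDsq]; ring
  -- (1) axes, (2) normal: data bounds with step t
  have hAstep : ∀ t : ℝ, 0 ≤ t → t ≤ 1 →
      2 * G₁ * ((4 + 2 * A) * t + Kp * (ρf + 2 * t) * t) / klScale e₀ m * 1 + 1 * 1 * (9 * (4 * Ba * ((1 + 2 * (sectorWidth (m + 1))⁻¹) * (2 * t)))) ≤
        t * ae1 / Λ ∧
      ((4 * G₂ + 2 * G₁) * ((4 + 2 * A) * t + Kp * (ρf + 2 * t) * t) ^ 2 / klScale e₀ m ^ 2 + 2 * G₁ * (Kp * t ^ 2) / klScale e₀ m) * 1 +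
        4 * G₁ * ((4 + 2 * A) * t + Kp * (ρf + 2 * t) * t) / klScale e₀ m * (9 * (4 * Ba * ((1 + 2 * (sectorWidth (m + 1))⁻¹) * (2 * t)))) +
        1 * 1 * (9 * (4 * Ba * ((1 + 2 * (sectorWidth (m + 1))⁻¹) * (2 * t)) ^ 2 + 8 * Ba ^ 2 * ((1 + 2 * (sectorWidth (m + 1))⁻¹) * (2 * t)) ^ 2)) ≤
        t ^ 2 * ae2 / Λ ^ 2 := by
    intro t ht0 ht1
    refine ⟨?_, ?_⟩
    · have h := fatA1_step_le (A := A) (ρf := ρf) (wsi := (sectorWidth (m + 1))⁻¹) (e₀ := e₀) hG₁0 hKp0 hΛ hΛm hB0 ht0 ht1 hcρ0 hNr1 hρfb hwsi hNrΛ'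
      rw [hae1]; exact h
    · have h := fatA2_step_le (wsi := (sectorWidth (m + 1))⁻¹) hG₁0 hG₂0 hA0 hKp0 hρf0 hΛ hΛm hB0 hwsi0 ht0 ht1 hcρ0 hNr1 hρfb hwsi hNrΛ' hΛe
      rw [hae2]; exact h
  have hrspace : ∀ t s : ℝ, 0 < t → t ≤ 1 → s = 2 * Λ / (π * (t * L / (2 * π)) * Real.sqrt qe) →
      (1 / (β * (L : ℝ) ^ 2)) ^ 2 *
        (1 * ((32 * B₂ + 144 * B₁ + 128) * (β * (L : ℝ) ^ 2) / Λ ^ 3 * (K₁ * (Real.sqrt 2 * t) + 4 * (K₂ * (Real.sqrt 2 * t) ^ 2)) ^ 2 +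
            (16 * B₁ + 16) * (β * (L : ℝ) ^ 2) / Λ ^ 2 * (K₂ * (Real.sqrt 2 * t) ^ 2)) +
          2 * ((2 * G₁ * ((4 + 2 * A) * t + Kp * (ρf + 2 * t) * t) / klScale e₀ m * 1 + 1 * 1 * (9 * (4 * Ba * ((1 + 2 * (sectorWidth (m + 1))⁻¹) * (2 * t))))) *
            ((16 * B₁ + 16) * (β * (L : ℝ) ^ 2) / Λ ^ 2 * (K₁ * (Real.sqrt 2 * t) + 3 * (K₂ * (Real.sqrt 2 * t) ^ 2)))) +
          (((4 * G₂ + 2 * G₁) * ((4 + 2 * A) * t + Kp * (ρf + 2 * t) * t) ^ 2 / klScale e₀ m ^ 2 + 2 * G₁ * (Kp * t ^ 2) / klScale e₀ m) * 1 +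
            4 * G₁ * ((4 + 2 * A) * t + Kp * (ρf + 2 * t) * t) / klScale e₀ m * (9 * (4 * Ba * ((1 + 2 * (sectorWidth (m + 1))⁻¹) * (2 * t)))) +
            1 * 1 * (9 * (4 * Ba * ((1 + 2 * (sectorWidth (m + 1))⁻¹) * (2 * t)) ^ 2 + 8 * Ba ^ 2 * ((1 + 2 * (sectorWidth (m + 1))⁻¹) * (2 * t)) ^ 2))) *
            (4 * (β * (L : ℝ) ^ 2) / Λ)) ≤
      (1 / (β * (L : ℝ) ^ 2)) ^ 2 * (4 * (β * (L : ℝ) ^ 2) / Λ) * (4 / (s * L)) ^ 2 := by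
    intro t s ht0 ht1 hs
    obtain ⟨h1, h2⟩ := hAstep t ht0.le ht1
    have h := spaceLeibniz_le (c₀ := (1 / (β * (L : ℝ) ^ 2)) ^ 2) (c := β * (L : ℝ) ^ 2) (C₁ := 16 * B₁ + 16) (C₂ := 32 * B₂ + 144 * B₁ + 128)
      hc₀ hcβ (by positivity) (by positivity) hK10 hK20 hΛ hΛe ht0.le ht1 hae10 h1 h2
    refine h.trans (le_of_eq ?_)
    rw [← hqe, hs]
    field_simp
    rw [hsesq]; ring
  have hr₁ := hrspace ℓ₁ s₁ hℓ₁0 hℓ₁le1 (by rw [hs₁, hℓ₁]; field_simp)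
  have hr₂ := hrspace ℓ s₂ hℓ0 hℓle1 (by rw [hs₂, hℓ]; field_simp)
  -- (3) tangent
  have hτt : |2 * π / (L : ℝ)| * (4 + 2 * A) + K₂ * (Real.sqrt 2 * ρf) * (Real.sqrt 2 * ℓ) ≤ ℓ / Nr * bτ := by
    rw [habs, hbτ]; exact tangentTau_le hA0 hK20 hℓ0.le hNr0 hℓ₁ℓNr hρfb
  have hτt0 : 0 ≤ |2 * π / (L : ℝ)| * (4 + 2 * A) + K₂ * (Real.sqrt 2 * ρf) * (Real.sqrt 2 * ℓ) := by positivity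
  have hl1abs : |2 * π / (L : ℝ)| ≤ ℓ / Nr := by rw [habs]; exact hℓ₁ℓNr
  have hAv1 := fatA1_tangent_le (wsi := (sectorWidth (m + 1))⁻¹) hG₁0 hA0 hKp0 hΛ hΛm hB0 hℓ0.le hNr1 hl1abs hρfb hℓNr hwsi hNrΛ
  have hAv2 := fatA2_tangent_le (wsi := (sectorWidth (m + 1))⁻¹) hG₁0 hG₂0 hA0 hKp0 hρf0 hΛ hΛm hB0 hℓ0.le (abs_nonneg (2 * π / (L : ℝ))) hNr1
    hl1abs hρfb hℓNr hwsi hwsi0 hNrΛ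
  have hr₃ : (1 / (β * (L : ℝ) ^ 2)) ^ 2 *
      (1 * ((32 * B₂ + 144 * B₁ + 128) * (β * (L : ℝ) ^ 2) / Λ ^ 3 *
            (|2 * π / (L : ℝ)| * (4 + 2 * A) + K₂ * (Real.sqrt 2 * ρf) * (Real.sqrt 2 * ℓ) + 4 * (K₂ * (Real.sqrt 2 * ℓ) ^ 2)) ^ 2 +
          (16 * B₁ + 16) * (β * (L : ℝ) ^ 2) / Λ ^ 2 * (K₂ * (Real.sqrt 2 * ℓ) ^ 2)) +
        2 * ((2 * G₁ * (|2 * π / (L : ℝ)| * (4 + 2 * A) + Kp * (ρf + 2 * ℓ) * ℓ) / klScale e₀ m * 1 +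
              1 * 1 * (9 * (4 * Ba * ((1 + 2 * (sectorWidth (m + 1))⁻¹) * (2 * ℓ))))) *
          ((16 * B₁ + 16) * (β * (L : ℝ) ^ 2) / Λ ^ 2 *
            (|2 * π / (L : ℝ)| * (4 + 2 * A) + K₂ * (Real.sqrt 2 * ρf) * (Real.sqrt 2 * ℓ) + 3 * (K₂ * (Real.sqrt 2 * ℓ) ^ 2)))) +
        (((4 * G₂ + 2 * G₁) * (|2 * π / (L : ℝ)| * (4 + 2 * A) + Kp * (ρf + 2 * ℓ) * ℓ) ^ 2 / klScale e₀ m ^ 2 + 2 * G₁ * (Kp * ℓ ^ 2) / klScale e₀ m) * 1 +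
          4 * G₁ * (|2 * π / (L : ℝ)| * (4 + 2 * A) + Kp * (ρf + 2 * ℓ) * ℓ) / klScale e₀ m * (9 * (4 * Ba * ((1 + 2 * (sectorWidth (m + 1))⁻¹) * (2 * ℓ)))) +
          1 * 1 * (9 * (4 * Ba * ((1 + 2 * (sectorWidth (m + 1))⁻¹) * (2 * ℓ)) ^ 2 + 8 * Ba ^ 2 * ((1 + 2 * (sectorWidth (m + 1))⁻¹) * (2 * ℓ)) ^ 2))) *
          (4 * (β * (L : ℝ) ^ 2) / Λ)) ≤
    (1 / (β * (L : ℝ) ^ 2)) ^ 2 * (4 * (β * (L : ℝ) ^ 2) / Λ) * (4 / (s₃ * L)) ^ 2 := by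
    have hAv1' := hAv1
    rw [← hav1] at hAv1'
    have hAv2' := hAv2
    rw [← hav2] at hAv2'
    have h := tangentLeibniz_le (c₀ := (1 / (β * (L : ℝ) ^ 2)) ^ 2) (c := β * (L : ℝ) ^ 2) (C₁ := 16 * B₁ + 16) (C₂ := 32 * B₂ + 144 * B₁ + 128)
      hc₀ hcβ (by positivity) (by positivity) hK20 hΛ hℓ0.le hNr1 hℓNr hNrΛ hτt0 hτt hav10 hAv1' hAv2'
    refine h.trans (le_of_eq ?_)
    rw [← hqv, hs₃, hℓ]
    field_simp
    rw [hsvsq]; ring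
  -- the per-pair theorem
  have hT := slicePair_bgmFat_le_all B hA hADt he hz hz1 hgap h3 hlo hhi hβ hρA m hMm hd hd1 hd2 hB0 hB hΛ hΛΛ' hM' hK₁ hK₂ hB₁ hB₂
    hNr2 hLz hR₀ rfl rfl rfl hG₁ hG₂ hKp rfl rfl rfl rfl rfl rfl rfl rfl hs₀0 hs₁0 hs₂0 hs₃0 hr₀ hr₁ hr₂ hr₃ ω ω'
  refine hT.trans ?_
  -- W and N̄s in closed form
  have h0 : 1 / s₀ = x₀ * ((M : ℝ) / β) / Λ := by rw [hs₀, hx₀]; field_simp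
  have h0' : 1 ≤ 1 / s₀ := by
    rw [h0, le_div_iff₀ hΛ, hx₀]
    have hD128 : (128 : ℝ) ≤ Dt := by
      rw [hDt]; have := mul_nonneg hG₁0 (show (0:ℝ) ≤ 16 * B₁ + 16 by positivity)
      linarith only [this, hG₁0, hG₂0, hB10, hB20]
    have hs11 : (11 : ℝ) ≤ Real.sqrt Dt := by
      rw [show (11 : ℝ) = Real.sqrt (11 ^ 2) by rw [Real.sqrt_sq (by norm_num)]]
      exact Real.sqrt_le_sqrt (by linarith only [hD128])
    have hMβ : 1 ≤ (M : ℝ) / β := by rw [le_div_iff₀ hβ]; linarith only [hβM]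
    have hΛ1 : Λ ≤ 1 := hΛe.trans he₁
    have hprod : (11 : ℝ) * 1 ≤ Real.sqrt Dt * ((M : ℝ) / β) := mul_le_mul hs11 hMβ zero_le_one (by positivity)
    have hge : (3 : ℝ) / 2 * (11 * 1) ≤ π / 2 * (Real.sqrt Dt * ((M : ℝ) / β)) :=
      mul_le_mul (by linarith only [Real.pi_gt_three]) hprod (by norm_num) (by positivity)
    calc 1 * Λ ≤ 1 := by linarith only [hΛ1]
      _ ≤ (3 : ℝ) / 2 * (11 * 1) := by norm_num
      _ ≤ π / 2 * (Real.sqrt Dt * ((M : ℝ) / β)) := hge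
      _ = π / 2 * Real.sqrt Dt * ((M : ℝ) / β) := by ring
  have h1 : 1 / s₁ = x₁ / Λ := by rw [hs₁, hx₁]; field_simp
  have hratio : (Nr + 1 / 2) / (Nr - 1) ≤ 5 / 2 := by
    rw [div_le_iff₀ (by linarith only [hNr2])]; linarith only [hNr2]
  have h2 : 1 / (s₂ * (Nr - 1)) ≤ x₂ / Λ := by
    rw [hs₂, hx₂]
    have e : 1 / (2 * Λ / (π * (Nr + 1 / 2) * Real.sqrt qe) * (Nr - 1)) = (π / 2 * Real.sqrt qe) * ((Nr + 1 / 2) / (Nr - 1)) / Λ := by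
      field_simp
    rw [e]
    refine div_le_div_of_nonneg_right ?_ hΛ.le
    calc π / 2 * Real.sqrt qe * ((Nr + 1 / 2) / (Nr - 1)) ≤ π / 2 * Real.sqrt qe * (5 / 2) := mul_le_mul_of_nonneg_left hratio (by positivity)
      _ = 5 * π / 4 * Real.sqrt qe := by ring
  have h3 : 1 / (s₃ * (Nr - 1)) ≤ x₃ * Nr := by
    rw [hs₃, hx₃]
    have e : 1 / (2 / (π * (Nr + 1 / 2) * Nr * Real.sqrt qv) * (Nr - 1)) = (π / 2 * Real.sqrt qv) * ((Nr + 1 / 2) / (Nr - 1)) * Nr := by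
      field_simp
    rw [e]
    refine mul_le_mul_of_nonneg_right ?_ hNr0.le
    calc π / 2 * Real.sqrt qv * ((Nr + 1 / 2) / (Nr - 1)) ≤ π / 2 * Real.sqrt qv * (5 / 2) := mul_le_mul_of_nonneg_left hratio (by positivity)
      _ = 5 * π / 4 * Real.sqrt qv := by ring
  have hW := wBracket_le (e₀ := e₀) (Mβ := (M : ℝ) / β) (L := (L : ℝ)) hs₀0 hs₁0 hs₂0 hs₃0 hΛ hΛe he₁ hNr2 (by positivity) hx₀0.le hx₂0 hx₃0 hδL hL
    h0 h0' h1 h2 h3 hΛL hR₀'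
  rw [← hCW] at hW
  have hY₁ : 2 ≤ Real.sqrt 2 * L * ((klScale e₀ m + (4 + 4 * A) * ρf ^ 2) / (2 * B.rhomin - 4 * A)) / π := by
    have h1' : 2 ≤ Real.sqrt 2 * L * (klScale e₀ m / (2 * B.rhomin - 4 * A)) / π := by
      rw [hΛm, le_div_iff₀ hπ, mul_div_assoc', le_div_iff₀ hγ]; linarith only [hL1]
    refine h1'.trans ?_
    gcongr
    exact le_add_of_nonneg_right (by positivity)
  have hY₂ : 2 ≤ Real.sqrt 2 * L * (2 * ρf) / π := by
    have hlow : π * Real.sqrt 2 * (π / Nr) ≤ ρf := by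
      rw [hρf, hw]
      have hsm := B.smax_pos; have hdt := B.Dtmin_pos
      have h1' : 0 ≤ (klScale e₀ m + B.smax * B.Dtmin * (3 * (π / Nr) / 4)) / (B.Dtmin - 2 * A) := by positivity
      have h2' : π * Real.sqrt 2 * (π / Nr) ≤ π * Real.sqrt 2 * (1 + (4 + 2 * A) / (B.Dtmin - 2 * A)) * (π / Nr) := by
        have h1'' : (1 : ℝ) ≤ 1 + (4 + 2 * A) / (B.Dtmin - 2 * A) := by
          have : 0 ≤ (4 + 2 * A) / (B.Dtmin - 2 * A) := by positivity
          linarith only [this]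
        have h2'' := mul_le_mul_of_nonneg_left h1'' (by positivity : 0 ≤ π * Real.sqrt 2 * (π / Nr))
        linarith only [h2'']
      linarith only [h1', h2']
    have hs2 : Real.sqrt 2 * Real.sqrt 2 = 2 := Real.mul_self_sqrt (by norm_num)
    have hLNr : Nr ≤ 2 * L := by
      have h1'' : 1 ≤ 2 * π * (Nr + 1 / 2) := by nlinarith only [Real.pi_gt_three, hNr0]
      have h2'' : Nr ≤ 2 * π * Nr * (Nr + 1 / 2) := by
        calc Nr = Nr * 1 := (mul_one _).symm
          _ ≤ Nr * (2 * π * (Nr + 1 / 2)) := mul_le_mul_of_nonneg_left h1'' hNr0.le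
          _ = 2 * π * Nr * (Nr + 1 / 2) := by ring
      linarith only [h2'', hLN, hL]
    rw [le_div_iff₀ hπ]
    calc 2 * π ≤ Real.sqrt 2 * L * (2 * (π * Real.sqrt 2 * (π / Nr))) := by
          rw [show Real.sqrt 2 * L * (2 * (π * Real.sqrt 2 * (π / Nr))) = (Real.sqrt 2 * Real.sqrt 2) * 2 * π * π * L / Nr by field_simp, hs2]
          rw [le_div_iff₀ hNr0]
          have h1'' : 2 * π * Nr ≤ 2 * π * (2 * L) := mul_le_mul_of_nonneg_left hLNr (by positivity)
          have h2'' : 2 * π * (2 * L) ≤ 2 * 2 * π * π * L := by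
            have h := mul_le_mul_of_nonneg_left (show (1 : ℝ) ≤ π by linarith only [Real.pi_gt_three])
              (by positivity : (0 : ℝ) ≤ 2 * 2 * π * L)
            linarith only [h]
          linarith only [h1'', h2'']
      _ ≤ Real.sqrt 2 * L * (2 * ρf) := by gcongr
  have hNs := fatSupport_le (Kp := 4 + 4 * A) hΛ hβ hL hγ hNr0 hc₁0 hΛm hπβ (by rw [← hKp]; exact hsh) hρfb (by positivity) hY₁ hY₂
  rw [← hCN] at hNs
  have hW0 : 0 ≤ 2048 * (1 / s₀ + 1) *
      (4 * ((2 * Real.sqrt 2 / (s₂ * (Nr - 1)) + 2) * (2 * Real.sqrt 2 / (s₃ * (Nr - 1)) + 2)) + 16 * (1 / s₁ + 1) ^ 2 / (1 + s₁ * R₀)) := by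
    have : 0 < Nr - 1 := by linarith only [hNr2]
    positivity
  have hNs0 : 0 ≤ (klScale e₀ m * β / π + 1) *
      ((Real.sqrt 2 * L * ((klScale e₀ m + (4 + 4 * A) * ρf ^ 2) / (2 * B.rhomin - 4 * A)) / π + 2) * (Real.sqrt 2 * L * (2 * ρf) / π + 2)) := by
    positivity
  rw [show ((2 * M : ℕ) : ℝ) = 2 * (M : ℝ) by push_cast; ring]
  exact alphaProduct_le hW0 hNs0 hCW0 hCN0 hMpos hβ hL hΛ hNr0 hW hNs

end Closed

end Summit.HubbardSuperconductivity.HubbardSuperconductivity.Theorems.TorusFourierL2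

end
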